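import Literature.MathematicalPhysics.QuantumFieldTheory.Balaban1983to89.B9CoReadingCoordsHolderSNear
import Literature.MathematicalPhysics.QuantumFieldTheory.Balaban1983to89.B9Eq340TransporterChangeY
import Literature.MathematicalPhysics.QuantumFieldTheory.Balaban1983to89.B9SmoothHolderClassTClosure
import Literature.MathematicalPhysics.QuantumFieldTheory.Balaban1983to89.B9Thm33G0ProbeZeroAtPinsAdm

/-!
# `Balaban1983to89.B9Eq340ProbeTransferSNY` — T. Bałaban, *Propagators for lattice gauge theories in a background field*, Commun. Math. Phys. **99** (1985) 389–434
# [Balaban1985BackgroundPropagators], (3.40) + (3.43) pp. 397–398: A (3.43) PROBE MEMBER OF THE NEAR SITE CARRIER `holderProbesSN` AT ONE TRANSPORTER TABLE IS A PROBE MEMBER AT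
# ANY NEARBY TABLE — the `𝔠_P^{(s−1)}` member of `Φ_s(g₁) ∘ T` plus the `𝔠^{(−1)}` sup member of `T` give the `𝔠_P^{(s−1)}` member of `Φ_s(g₂) ∘ T`, for tables with
# `(η|z − z′|_T)^{−s}·‖g₁(z,z′) − g₂(z,z′)‖ ≤ θ·(Lʲη)^{−s}` on near pairs; at NODE 00's record `g₁ = parSymY`, `g₂ = parSY = taxiS` under print's (3.35) with θ = (d+1)²·K_pl·L⁶

[4] = T. Bałaban, *Propagators and renormalization transformations for lattice gauge theories. II*, Commun. Math. Phys. **96** (1984) 223–250 [`Balaban1984PropagatorsII`].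
statement-level skeleton of published theorems with citation tags; proofs where landed; nothing here is a claim about the Yang–Mills mass gap.

THE PRINT.  (3.40) p. 397 (the covariant Hölder quotient along «a shortest contour»), (3.42)₂,₃ p. 397 (the sup members `B₀Lʲη` of `∇_UG′`, `G′∇\*_U`), (3.43) p. 398 (their Hölder
members `B₀(β)(Lʲη)^{1−β}`); (3.35) p. 396 with (3.69) p. 404 (the plaquette scale).

WHY THIS FILE (cell `pub-ymgap`, node N06 [B9], seat `pub-ymgap-dag-n06-c` g19; road R3 of the G′ Hölder layer `hp45W hpDGW h44G h43Gp` of rows 20–21 — dag-n06-d `DISPLAY-LEDGER-UF.md`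
§2, dag-n06-l g22 LOCATED (i)).  The rows-18 engine (n06-k `holder343_of_local37`) delivers the (3.43) probe members of `∇_UG′`, `G′∇\*_U` at the near site carrier
`holderProbesSN … (𝔏 x).parS` whose table is the record's `parSymY`; the rows-20–21 site class `bH13 = bHZPG (taxiS U)` reads `taxiS = parSY`.  `B9Eq340TransporterChangeY` §5
bounds the two tables' distance on near pairs by `(d+1)²K_pl L⁶·(|z−z′|_T∕Lʲ)²`; THIS FILE turns a probe member at `parSymY` into a probe member at `parSY` (pattern of dag-n06-l
g27's `B9HolderProbesKAFromGradSrc`, whose gradient input is replaced by the other table's probe member):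
* §1 pointwise, one site function `F` with the `𝔠^{(−1)}` input `|F| ≤ C₀·len·e^{−δd(·,y′)}·M`: ★ `pairProbe_transfer_le` — on a near pair the pair probe along `g₂` is the pair
  probe along `g₁` plus `2·c_b·b_b·(w‖g₁ − g₂‖)·‖-weighted point term` (`‖R(g₁)X − R(g₂)X‖ ≤ 2‖g₁−g₂‖‖X‖`, unitary-like tables); `transProbe_le_of_supS`, `pointProbe_le_of_supS`
  (the `1`-weighted (transported) point probes of the site family from the sup input).
* §2 ★★★ `hasMaj_probesSN_transfer` — for ANY source class `b`, ANY `T` into the site carrier, any two unitary-like tables `g₁, g₂` with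
  `wSN s z z′·‖g₁ − g₂‖ ≤ θ·len(y(z))^{−s}` on near pairs: `HasMaj b 𝔠_P^{(s−1)} (Φ_s(g₁)∘T) (C_b e^{−δd})` + `HasMaj b 𝔠^{(−1)} T (C₀ e^{−δd})` ⟹
  `HasMaj b 𝔠_P^{(s−1)} (Φ_s(g₂)∘T) ((C_b + 2c_b b_b L e^{δr₀}θ C₀ + c_b b_b C₀ + C₀) e^{−δd})`, `r₀ = (d+1)(L+1)+2` (n06-w6's near-pair block geometry).
* §3 at the record: ★ `wSN_mul_norm_parSymY_sub_parSY_le` (θ = (d+1)²K_pl L⁶ under print's (3.35), `0 ≤ s ≤ 2`, via `norm_parSymY_sub_parSY_le_of_reg335P` and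
  `(|z−z′|_T∕Lʲ)^{2−s} ≤ 1`), ★★★ `hasMaj_probesSN_parSY_of_parSymY` — the SN probe member at `parSY` (= `taxiS`) from the one at `parSymY` and the sup member.

HONEST SCOPE.  Finite-dimensional bookkeeping over landed letters; the probe member at `parSymY` and the sup member are HYPOTHESES of printed shape ((3.43), (3.42)); nothing of [B9]
asserted; COUNT-NEUTRAL; N06 NOT discharged; nothing continuum, nothing about the mass gap.  Cell `pub-ymgap` (HUMAN RULING D-0062), Track A node N06 [B9], seat
`pub-ymgap-dag-n06-c` (g19), 2026-08-29; a NEW file; 0 `def`, no `sorry`, no `axiom`, no `instance`, no `notation`.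
-/

namespace Literature.MathematicalPhysics.QuantumFieldTheory.Balaban1983to89.B9Eq340ProbeTransferSNY

open LatticeFieldCalculus (supDist)
open B9Eq39Adjoint (R R_sub)
open B4TorusKernel.MultiPeriod (torusSupNorm torusSupNorm_nonneg)
open B9BackgroundsKLevelV1 (CfgV1)
open B9BackgroundsKLevelV1P (bg9KP)
open B6GlobalChartV1 (PV blkV1 domT boxEquiv)
open B6Geom246MultiLevelBox (blkOf)
open B6Ineq2142KLevelV1 (β lvl)
open B6KLevelCensusIndexV1 (KIdx kGeo len_eq)
open B6Geom246MultiLevelTorus (geomT torusSupNorm_neg)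
open B6MultiLevelTorusOperator (one_le_of_mem)
open B6Prop22KLevelTorusCensusEta (nKT nKT_pos)
open B9Thm34Ext (toB6)
open B9GeoNormsKLevelV1 (geo9K)
open B9GeoLemma21KLevelV1 (geo9K_len_pos)
open B9Thm39ReadingCoords (coordBound39 basisBound39 abs_repr_le)
open B9CoReadingCoords (assembleK)
open B9CoReadingCoordsS (XSK blkSK sIK blkV1_site)
open B9CoReadingCoordsHolder (PK blkPK probeK probeK_inl probeK_inr_inl probeK_inr_inr)
open B9CoReadingCoordsHolderS (wS wS_nonneg)
open B9CoReadingCoordsHolderSNear (NearS wSN wSN_of_near wSN_nonneg holderProbesSN ΦX_SN_eq ΦX_SN_inl_of_not_near)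
open Node00 (SiteY FBondY IBondY CfgY SiteParY parSY parSymY toKT levY)
open Node00.OpsYHolderFar (pdist)
open B9Eq340TaxiTelescope (norm_R_le)
open B9Eq340NearPairBlocks (near_exp_carrier_le near_len_carrier_le)
open B9Thm33G0ProbeZeroAtPinsAdm (norm_assembleK_le unitaryLike_parTaxiV)
open B9Eq340TransporterChangeY (norm_parSymY_sub_parSY_le_of_reg335P supDist_symm_le_torusSupNorm)
open B9Eq340CovariantLipschitzY (pdist_pos_of_ne)
open T4RelativeLadder (UnitaryLike norm_unit_mul_le norm_mul_unit_le)
open B9Thm312Whole (GeoOK)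
open B9Thm312WholeClasses (cNormR cNormR_loc)
open B9SmoothHolderClassTClosure (abs_apply_le_of_hasMaj_cNormR len_le_one)
open B11SectG (BlockNorm HasMaj)

noncomputable section

variable {d ℓ : ℕ} {hd : 1 ≤ d + 1} {hL : Odd (ℓ + 1) ∧ 1 < ℓ + 1} {b₀ b₁ : ℝ}
variable {𝔸 : Type} [NormedRing 𝔸] [NormedAlgebra ℂ 𝔸] [CompleteSpace 𝔸]
variable {κ : Type} [Fintype κ] [DecidableEq κ]

/-! ## §1 One site function: the three probe kinds along a second table -/

section Pointwise

variable (i : KIdx d ℓ hd hL b₀ b₁) (b : Module.Basis κ ℝ 𝔸) [FiniteDimensional ℝ 𝔸] [Fintype (geo9K i).Site]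
variable {B : B9.Backgrounds} (cfg : B.Cfg → CfgY 𝔸 i) (U₁ : B.Cfg) {bI : FBondY i → IBondY i}

/-- the adjoint actions of two unitary-like transporters differ by twice their distance (`B9Eq380CubeLetters.norm_R_sub_R_le_of_unitaryLike`, re-derived here in three lines to
keep the import light). [cite: Balaban1985BackgroundPropagators, (3.3) p.390, folklore] -/
private theorem norm_R_sub_R_le' {𝔹 : Type} [NormedRing 𝔹] [NormOneClass 𝔹] {g₁ g₂ : 𝔹ˣ} (h₁ : UnitaryLike g₁) (h₂ : UnitaryLike g₂) (X : 𝔹) :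
    ‖R g₁ X - R g₂ X‖ ≤ 2 * ‖(g₁ : 𝔹) - g₂‖ * ‖X‖ := by
  have hinv : ((g₁⁻¹ : 𝔹ˣ) : 𝔹) - ((g₂⁻¹ : 𝔹ˣ) : 𝔹) = ((g₁⁻¹ : 𝔹ˣ) : 𝔹) * ((g₂ : 𝔹) - g₁) * ((g₂⁻¹ : 𝔹ˣ) : 𝔹) := by
    rw [mul_sub, sub_mul, Units.mul_inv_cancel_right, Units.inv_mul, one_mul]
  have hinvn : ‖((g₁⁻¹ : 𝔹ˣ) : 𝔹) - ((g₂⁻¹ : 𝔹ˣ) : 𝔹)‖ ≤ ‖(g₁ : 𝔹) - g₂‖ := by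
    rw [hinv]
    calc _ ≤ ‖((g₁⁻¹ : 𝔹ˣ) : 𝔹) * ((g₂ : 𝔹) - g₁)‖ := norm_mul_unit_le h₂.inv _
      _ ≤ ‖(g₂ : 𝔹) - g₁‖ := norm_unit_mul_le h₁.inv _
      _ = ‖(g₁ : 𝔹) - g₂‖ := norm_sub_rev _ _
  have hsplit : R g₁ X - R g₂ X = ((g₁ : 𝔹) - g₂) * X * ((g₁⁻¹ : 𝔹ˣ) : 𝔹) + (g₂ : 𝔹) * X * (((g₁⁻¹ : 𝔹ˣ) : 𝔹) - ((g₂⁻¹ : 𝔹ˣ) : 𝔹)) := by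
    simp only [R]; noncomm_ring
  rw [hsplit]
  calc _ ≤ ‖((g₁ : 𝔹) - g₂) * X * ((g₁⁻¹ : 𝔹ˣ) : 𝔹)‖ + ‖(g₂ : 𝔹) * X * (((g₁⁻¹ : 𝔹ˣ) : 𝔹) - ((g₂⁻¹ : 𝔹ˣ) : 𝔹))‖ := norm_add_le _ _
    _ ≤ ‖(g₁ : 𝔹) - g₂‖ * ‖X‖ + ‖X‖ * ‖(g₁ : 𝔹) - g₂‖ := by
        refine add_le_add ?_ ?_
        · exact (norm_mul_unit_le h₁.inv _).trans (norm_mul_le _ _)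
        · rw [mul_assoc]
          exact (norm_unit_mul_le h₂ _).trans ((norm_mul_le _ _).trans (mul_le_mul_of_nonneg_left hinvn (norm_nonneg _)))
    _ = 2 * ‖(g₁ : 𝔹) - g₂‖ * ‖X‖ := by ring

omit [DecidableEq κ] [Fintype (geo9K i).Site] in
/-- the anchor of a site `z` is the block of the site bond `⟨chart⁻¹ z, 0⟩`, so n06-w6's near-bond geometry applies to near sites. [cite: Balaban1984PropagatorsII, (2.1) p.224, bookkeeping] -/
theorem nearS_supDist {z z' : SiteY i} (h : NearS i z z') :
    supDist (⟨(boxEquiv i.hN).symm z, 0⟩ : FBondY i).src (⟨(boxEquiv i.hN).symm z', 0⟩ : FBondY i).src ≤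
      (ℓ + 1) ^ (blkV1 i.hN i.D (⟨(boxEquiv i.hN).symm z, 0⟩ : FBondY i)).1.1 := by
  have h1 := supDist_symm_le_torusSupNorm i z' z
  rw [← neg_sub z.1 z'.1, torusSupNorm_neg (fun μ => one_le_of_mem z.2 μ)] at h1
  have h2 : (supDist ((boxEquiv i.hN).symm z) ((boxEquiv i.hN).symm z') : ℝ) ≤ (((ℓ + 1 : ℕ) : ℝ)) ^ levY i z := h1.trans h
  have h3 : supDist ((boxEquiv i.hN).symm z) ((boxEquiv i.hN).symm z') ≤ (ℓ + 1) ^ levY i z := by exact_mod_cast h2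
  rw [blkV1_site]
  exact h3

omit [DecidableEq κ] [Fintype (geo9K i).Site] in
/-- ★ **THE PAIR PROBE ALONG A SECOND TABLE** (near pair, anchored at `y(z)`): `|Φ_s(g₂)F((z,z′),…)| ≤ |Φ_s(g₁)F((z,z′),…)| + 2·c_b·b_b·(w_s(z,z′)·‖g₁(z,z′) − g₂(z,z′)‖)·C₀·len(y(z′))·
e^{−δ d(y(z′),y′)}·M` — the two pair probes differ by the weighted coordinate of `(R(g₁) − R(g₂))Ψ(z′)`, bounded by the sup input at `z′`.
[cite: Balaban1985BackgroundPropagators, (3.40) p.397 + (3.42) p.397 + (3.43) p.398] -/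
theorem pairProbe_transfer_le [NormOneClass 𝔸] (par₁ par₂ : SiteParY 𝔸 i) (hu₁ : ∀ z z' : SiteY i, UnitaryLike (par₁ (cfg U₁) z z'))
    (hu₂ : ∀ z z' : SiteY i, UnitaryLike (par₂ (cfg U₁) z z')) (F : XSK κ i → ℝ) {C₀ δ M : ℝ} {y' : IBondY i}
    (hF0 : ∀ q : XSK κ i, |F q| ≤ C₀ * (geo9K i).len (sIK i bI q.1) * Real.exp (-(δ * (geo9K i).dist (sIK i bI q.1) y')) * M)
    (s : ℝ) (z z' : SiteY i) (ν : Fin (d + 1)) (c c' : κ) :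
    |(holderProbesSN i b B cfg par₂ bI).ΦX U₁ s F (Sum.inl ((z, z'), ν, c, c'))| ≤
      |(holderProbesSN i b B cfg par₁ bI).ΦX U₁ s F (Sum.inl ((z, z'), ν, c, c'))| +
        2 * coordBound39 b * basisBound39 b * (wSN i s z z' * ‖(par₁ (cfg U₁) z z' : 𝔸) - (par₂ (cfg U₁) z z' : 𝔸)‖) *
          (C₀ * (geo9K i).len (sIK i bI z') * Real.exp (-(δ * (geo9K i).dist (sIK i bI z') y')) * M) := by
  rw [ΦX_SN_eq, ΦX_SN_eq, probeK_inl, probeK_inl]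
  set Ψ : SiteY i → 𝔸 := assembleK b ν c' F with hΨ
  dsimp only
  set w : ℝ := wSN i s z z' with hw
  have hw0 : 0 ≤ w := wSN_nonneg i s z z'
  have hcB : 0 ≤ coordBound39 b := by unfold coordBound39; exact norm_nonneg _
  -- the difference of the two pair probes
  have hdiff : w * b.repr (Ψ z - R (par₂ (cfg U₁) z z') (Ψ z')) c =
      w * b.repr (Ψ z - R (par₁ (cfg U₁) z z') (Ψ z')) c + w * b.repr (R (par₁ (cfg U₁) z z') (Ψ z') - R (par₂ (cfg U₁) z z') (Ψ z')) c := by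
    rw [← mul_add, ← Finsupp.add_apply, ← map_add]
    congr 2; abel
  rw [hdiff]
  refine (abs_add_le _ _).trans (add_le_add le_rfl ?_)
  rw [abs_mul, abs_of_nonneg hw0]
  have hΨ' : ‖Ψ z'‖ ≤ basisBound39 b * (C₀ * (geo9K i).len (sIK i bI z') * Real.exp (-(δ * (geo9K i).dist (sIK i bI z') y')) * M) :=
    norm_assembleK_le b ν c' _ z' fun a => hF0 (z', ν, a, c')
  have hR := norm_R_sub_R_le' (hu₁ z z') (hu₂ z z') (Ψ z')
  have hB0 : 0 ≤ basisBound39 b * (C₀ * (geo9K i).len (sIK i bI z') * Real.exp (-(δ * (geo9K i).dist (sIK i bI z') y')) * M) :=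
    (norm_nonneg _).trans hΨ'
  calc w * |b.repr (R (par₁ (cfg U₁) z z') (Ψ z') - R (par₂ (cfg U₁) z z') (Ψ z')) c|
      ≤ w * (coordBound39 b * ‖R (par₁ (cfg U₁) z z') (Ψ z') - R (par₂ (cfg U₁) z z') (Ψ z')‖) := mul_le_mul_of_nonneg_left (abs_repr_le b _ c) hw0
    _ ≤ w * (coordBound39 b * (2 * ‖(par₁ (cfg U₁) z z' : 𝔸) - (par₂ (cfg U₁) z z' : 𝔸)‖ * ‖Ψ z'‖)) :=
        mul_le_mul_of_nonneg_left (mul_le_mul_of_nonneg_left hR hcB) hw0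
    _ ≤ w * (coordBound39 b * (2 * ‖(par₁ (cfg U₁) z z' : 𝔸) - (par₂ (cfg U₁) z z' : 𝔸)‖ *
          (basisBound39 b * (C₀ * (geo9K i).len (sIK i bI z') * Real.exp (-(δ * (geo9K i).dist (sIK i bI z') y')) * M)))) :=
        mul_le_mul_of_nonneg_left (mul_le_mul_of_nonneg_left (mul_le_mul_of_nonneg_left hΨ' (by positivity)) hcB) hw0
    _ = _ := by ring

omit [DecidableEq κ] [Fintype (geo9K i).Site] in
/-- ★ **THE TRANSPORTED POINT PROBE FROM THE SUP INPUT** (site family: point weight `1`, ANY pair, anchored at `y(z′)`, unitary-like transport):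
`|repr_c(R(g(z,z′))Ψ(z′))| ≤ c_b·b_b·C₀·len(y(z′))·e^{−δ d(y(z′),y′)}·M`. [cite: Balaban1985BackgroundPropagators, (3.40) + (3.42) p.397] -/
theorem transProbe_le_of_supS [NormOneClass 𝔸] (par : SiteParY 𝔸 i) (hu : ∀ z z' : SiteY i, UnitaryLike (par (cfg U₁) z z'))
    (F : XSK κ i → ℝ) {C₀ δ M : ℝ} {y' : IBondY i}
    (hF0 : ∀ q : XSK κ i, |F q| ≤ C₀ * (geo9K i).len (sIK i bI q.1) * Real.exp (-(δ * (geo9K i).dist (sIK i bI q.1) y')) * M)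
    (s : ℝ) (z z' : SiteY i) (ν : Fin (d + 1)) (c c' : κ) :
    |(holderProbesSN i b B cfg par bI).ΦX U₁ s F (Sum.inr (Sum.inl ((z, z'), ν, c, c')))| ≤
      coordBound39 b * basisBound39 b * (C₀ * (geo9K i).len (sIK i bI z') * Real.exp (-(δ * (geo9K i).dist (sIK i bI z') y')) * M) := by
  rw [ΦX_SN_eq, probeK_inr_inl, one_mul]
  set Ψ : SiteY i → 𝔸 := assembleK b ν c' F with hΨ
  have hcB : 0 ≤ coordBound39 b := by unfold coordBound39; exact norm_nonneg _
  have hΨ' : ‖Ψ z'‖ ≤ basisBound39 b * (C₀ * (geo9K i).len (sIK i bI z') * Real.exp (-(δ * (geo9K i).dist (sIK i bI z') y')) * M) :=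
    norm_assembleK_le b ν c' _ z' fun a => hF0 (z', ν, a, c')
  calc |b.repr (R (par (cfg U₁) z z') (Ψ z')) c| ≤ coordBound39 b * ‖R (par (cfg U₁) z z') (Ψ z')‖ := abs_repr_le b _ c
    _ ≤ coordBound39 b * ‖Ψ z'‖ := mul_le_mul_of_nonneg_left (norm_R_le (hu z z') _) hcB
    _ ≤ _ := by rw [mul_assoc]; exact mul_le_mul_of_nonneg_left hΨ' hcB

omit [DecidableEq κ] [FiniteDimensional ℝ 𝔸] [Fintype (geo9K i).Site] in
/-- ★ **THE POINT PROBE FROM THE SUP INPUT** (weight `1`, anchored at `y(z)`). [cite: Balaban1985BackgroundPropagators, (3.39) + (3.42) p.397] -/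
theorem pointProbe_le_of_supS (par : SiteParY 𝔸 i) (F : XSK κ i → ℝ) {C₀ δ M : ℝ} {y' : IBondY i}
    (hF0 : ∀ q : XSK κ i, |F q| ≤ C₀ * (geo9K i).len (sIK i bI q.1) * Real.exp (-(δ * (geo9K i).dist (sIK i bI q.1) y')) * M)
    (s : ℝ) (z : SiteY i) (ν : Fin (d + 1)) (c c' : κ) :
    |(holderProbesSN i b B cfg par bI).ΦX U₁ s F (Sum.inr (Sum.inr (z, ν, c, c')))| ≤
      C₀ * (geo9K i).len (sIK i bI z) * Real.exp (-(δ * (geo9K i).dist (sIK i bI z) y')) * M := by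
  rw [ΦX_SN_eq, probeK_inr_inr, one_mul]
  exact hF0 (z, ν, c, c')

end Pointwise

/-! ## §2 ★★★ The probe member along a second table -/

section Package

variable (i : KIdx d ℓ hd hL b₀ b₁) (b : Module.Basis κ ℝ 𝔸) [FiniteDimensional ℝ 𝔸] [Fintype (geo9K i).Site]
variable {B : B9.Backgrounds} (cfg : B.Cfg → CfgY 𝔸 i) (U₁ : B.Cfg) {bI : FBondY i → IBondY i}
variable {R₀ : ℝ} {H₀ : Prop} {F₁ : Type} [AddCommGroup F₁] [Module ℝ F₁]

/-- the sharp-block sup of `f` at `y` is below any `M ≥ 0` bounding `|f|` on the block. [folklore] -/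
private theorem ofBlocks_loc_le_of_forall {X : Type} [Fintype X] (blk : X → IBondY i) {y : IBondY i} {f : X → ℝ} {M : ℝ} (hM : 0 ≤ M)
    (h : ∀ x, blk x = y → |f x| ≤ M) : (BlockNorm.ofBlocks (toB6 (geo9K i) R₀ H₀) blk).loc y f ≤ M := by
  classical
  show (⨆ x : X, @ite ℝ (blk x = y) (Classical.propDecidable _) |f x| 0) ≤ M
  refine Real.iSup_le (fun x => ?_) hM
  split_ifs with hx
  · exact h x hx
  · exact hM

omit [DecidableEq κ] in
/-- ★★★ **A PROBE MEMBER OF THE NEAR SITE CARRIER ALONG ONE TABLE IS A PROBE MEMBER ALONG ANY NEARBY TABLE.**  For ANY source class `b`, ANY `T` into the site carrier, any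
`0 ≤ s`, any two tables `g₁, g₂` of unitary-like transporters with `w_s(z,z′)·‖g₁(z,z′) − g₂(z,z′)‖ ≤ θ·len(y(z))^{−s}` on every near pair (`θ ≥ 0`): if
`Φ_s(g₁) ∘ T : b → 𝔠_P^{(s−1)}` has the majorant `C_b e^{−δd}` ((3.43)-shape at `g₁`) and `T : b → 𝔠^{(−1)}` has `C₀ e^{−δd}` ((3.42)₂,₃-shape), then
`Φ_s(g₂) ∘ T : b → 𝔠_P^{(s−1)}` with `(C_b + 2c_b b_b·L·e^{δr₀}·θ·C₀ + c_b b_b C₀ + C₀)·e^{−δd}`, `r₀ = (d+1)(L+1)+2`.  Pair probes: `0` off the near pairs (both families),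
§1's transfer on them, the neighbour's anchor `y(z′)` one level and `r₀` away from `y(z)` (n06-w6 `near_len_carrier_le ∕ near_exp_carrier_le`); the (transported) point
probes straight from the sup member, their weight `1` costing `len(y)^{s} ≤ 1`.  Binders: the certificate's `hlev hβ1`, print's units `hcf`.
[cite: Balaban1985BackgroundPropagators, (3.40) p.397 («a shortest contour») + (3.42)–(3.43) pp.397–398; Balaban1984PropagatorsII, (2.51)–(2.54) pp.232–233] -/
theorem hasMaj_probesSN_transfer [NormOneClass 𝔸] (hG : GeoOK (geo9K i)) (par₁ par₂ : SiteParY 𝔸 i)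
    (hu₁ : ∀ z z' : SiteY i, UnitaryLike (par₁ (cfg U₁) z z')) (hu₂ : ∀ z z' : SiteY i, UnitaryLike (par₂ (cfg U₁) z z'))
    (hlev : ∀ x : FBondY i, lvl i.hN i.D i.hk (bI x) = (blkV1 i.hN i.D x).1.1)
    (hβ1 : ∀ x : FBondY i, (geomT i.D).dist (β i.hN i.D i.hk (bI x)) (blkV1 i.hN i.D x) ≤ 1) (hcf : |i.cf| = (nKT (toKT i) : ℝ))
    {s θ : ℝ} (hs : 0 ≤ s) (hθ : 0 ≤ θ)
    (hg : ∀ z z' : SiteY i, NearS i z z' →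
      wSN i s z z' * ‖(par₁ (cfg U₁) z z' : 𝔸) - (par₂ (cfg U₁) z z' : 𝔸)‖ ≤ θ * (geo9K i).len (sIK i bI z) ^ (-s))
    {bS : BlockNorm (toB6 (geo9K i) R₀ H₀) F₁} {T : F₁ →ₗ[ℝ] (XSK κ i → ℝ)} {C₀ Cb δ : ℝ} (hC₀ : 0 ≤ C₀) (hCb : 0 ≤ Cb) (hδ : 0 ≤ δ)
    (hsup : HasMaj bS (cNormR R₀ H₀ (blkSK i (sIK i bI)) hG.lenle (-1)) T (fun a a' => C₀ * Real.exp (-(δ * (geo9K i).dist a a'))))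
    (hpr : HasMaj bS (cNormR R₀ H₀ (blkPK (sIK i bI)) hG.lenle (s - 1)) ((holderProbesSN i b B cfg par₁ bI).ΦX U₁ s ∘ₗ T)
      (fun a a' => Cb * Real.exp (-(δ * (geo9K i).dist a a')))) :
    HasMaj bS (cNormR R₀ H₀ (blkPK (sIK i bI)) hG.lenle (s - 1)) ((holderProbesSN i b B cfg par₂ bI).ΦX U₁ s ∘ₗ T)
      (fun a a' => (Cb + 2 * coordBound39 b * basisBound39 b * ((ℓ : ℝ) + 1) * Real.exp (δ * (((d : ℝ) + 1) * (((ℓ : ℝ) + 1) + 1) + 2)) * θ * C₀ +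
        coordBound39 b * basisBound39 b * C₀ + C₀) * Real.exp (-(δ * (geo9K i).dist a a'))) := by
  classical
  set r₀ : ℝ := ((d : ℝ) + 1) * (((ℓ : ℝ) + 1) + 1) + 2 with hr₀
  set CX : ℝ := 2 * coordBound39 b * basisBound39 b * ((ℓ : ℝ) + 1) * Real.exp (δ * r₀) * θ * C₀ with hCX
  set CT : ℝ := coordBound39 b * basisBound39 b * C₀ with hCT
  have hcB : 0 ≤ coordBound39 b := by unfold coordBound39; exact norm_nonneg _
  have hbB : 0 ≤ basisBound39 b := Finset.sum_nonneg fun _ _ => norm_nonneg _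
  have hL0 : (0 : ℝ) ≤ (ℓ : ℝ) + 1 := by positivity
  have hCX0 : 0 ≤ CX := by rw [hCX]; positivity
  have hCT0 : 0 ≤ CT := by rw [hCT]; positivity
  set Ctot : ℝ := Cb + CX + CT + C₀ with hCtot
  have hCtot0 : 0 ≤ Ctot := by rw [hCtot]; linarith
  intro y' μ hμ y
  set M : ℝ := bS.loc y' μ with hMdef
  have hM : 0 ≤ M := bS.loc_nonneg _ _
  -- the sup input, value by value
  have hF0 : ∀ q : XSK κ i, |T μ q| ≤ C₀ * (geo9K i).len (sIK i bI q.1) * Real.exp (-(δ * (geo9K i).dist (sIK i bI q.1) y')) * M := by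
    intro q
    have hv := abs_apply_le_of_hasMaj_cNormR i hG.lenle hsup hμ q
    have hl : 0 < (geo9K i).len (sIK i bI q.1) := geo9K_len_pos i _
    rw [show blkSK i (sIK i bI) q = sIK i bI q.1 from rfl, Real.rpow_neg hl.le, inv_inv, Real.rpow_one] at hv
    refine hv.trans (le_of_eq ?_)
    ring
  -- the probe member at the first table, value by value
  have hF1 : ∀ p : PK (SiteY i) (Fin (d + 1)) κ, |((holderProbesSN i b B cfg par₁ bI).ΦX U₁ s (T μ)) p| ≤
      (geo9K i).len (blkPK (sIK i bI) p) ^ (1 - s) * (Cb * Real.exp (-(δ * (geo9K i).dist (blkPK (sIK i bI) p) y'))) * M := by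
    intro p
    have hv := abs_apply_le_of_hasMaj_cNormR i hG.lenle hpr hμ p
    have hl : 0 < (geo9K i).len (blkPK (sIK i bI) p) := geo9K_len_pos i _
    rw [LinearMap.comp_apply] at hv
    rw [← Real.rpow_neg hl.le, neg_sub] at hv
    exact hv
  -- every probe of the second family anchored at `y` is `≤ Ctot·len(y)^{1−s}·e^{−δ d(y,y′)}·M`
  have hlen1 : ∀ w : IBondY i, (geo9K i).len w ≤ 1 := len_le_one i hcf
  have hpt : ∀ idx : PK (SiteY i) (Fin (d + 1)) κ, blkPK (sIK i bI) idx = y →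
      |(holderProbesSN i b B cfg par₂ bI).ΦX U₁ s (T μ) idx| ≤
        Ctot * (geo9K i).len y ^ (1 - s) * Real.exp (-(δ * (geo9K i).dist y y')) * M := by
    intro idx hidx
    -- a bound `C·len(y)·e·M` or `C·len(y)^{1−s}·e·M` with `C ≤ Ctot` is a bound `Ctot·len(y)^{1−s}·e·M` (`len ≤ 1`, `0 ≤ s`)
    have hl0 : 0 < (geo9K i).len y := geo9K_len_pos i y
    have hls : (geo9K i).len y ≤ (geo9K i).len y ^ (1 - s) := by
      have h := Real.rpow_le_rpow_of_exponent_ge hl0 (hlen1 y) (show (1 : ℝ) - s ≤ 1 by linarith)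
      rwa [Real.rpow_one] at h
    have hE := Real.exp_nonneg (-(δ * (geo9K i).dist y y'))
    have hup1 : ∀ {C a : ℝ}, C ≤ Ctot → 0 ≤ C →
        a ≤ C * (geo9K i).len y ^ (1 - s) * Real.exp (-(δ * (geo9K i).dist y y')) * M →
        a ≤ Ctot * (geo9K i).len y ^ (1 - s) * Real.exp (-(δ * (geo9K i).dist y y')) * M := by
      intro C a hCle _ h
      refine h.trans ?_
      have hl : 0 ≤ (geo9K i).len y ^ (1 - s) := Real.rpow_nonneg hl0.le _
      exact mul_le_mul_of_nonneg_right (mul_le_mul_of_nonneg_right (mul_le_mul_of_nonneg_right hCle hl) hE) hM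
    have hup0 : ∀ {C a : ℝ}, C ≤ Ctot → 0 ≤ C →
        a ≤ C * (geo9K i).len y * Real.exp (-(δ * (geo9K i).dist y y')) * M →
        a ≤ Ctot * (geo9K i).len y ^ (1 - s) * Real.exp (-(δ * (geo9K i).dist y y')) * M := by
      intro C a hCle hC0 h
      refine hup1 hCle hC0 (h.trans ?_)
      exact mul_le_mul_of_nonneg_right (mul_le_mul_of_nonneg_right (mul_le_mul_of_nonneg_left hls hC0) hE) hM
    rcases idx with ⟨⟨z, z'⟩, ν, c, c'⟩ | ⟨⟨z, z'⟩, ν, c, c'⟩ | ⟨z, ν, c, c'⟩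
    · -- pair probe anchored at `y = y(z)`
      have hz : sIK i bI z = y := hidx
      subst hz
      by_cases hnear : NearS i z z'
      · -- §1's transfer + the probe member at `g₁` + the neighbour geometry
        have hnb := nearS_supDist i hnear
        have hlen := (near_len_carrier_le i hlev hnb).1
        have hexp := near_exp_carrier_le i hβ1 hnb hδ y'
        -- `sIK z = bI ⟨chart⁻¹ z, 0⟩` definitionally
        change (kGeo i).len (sIK i bI z') ≤ ((ℓ : ℝ) + 1) * (kGeo i).len (sIK i bI z) at hlen
        change Real.exp (-(δ * (kGeo i).dist (sIK i bI z') y')) ≤ Real.exp (δ * r₀) * Real.exp (-(δ * (kGeo i).dist (sIK i bI z) y')) at hexp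
        have h1 := pairProbe_transfer_le i b cfg U₁ par₁ par₂ hu₁ hu₂ (T μ) hF0 s z z' ν c c'
        have hP1 := hF1 (Sum.inl ((z, z'), ν, c, c'))
        change |((holderProbesSN i b B cfg par₁ bI).ΦX U₁ s (T μ)) (Sum.inl ((z, z'), ν, c, c'))| ≤
          (geo9K i).len (sIK i bI z) ^ (1 - s) * (Cb * Real.exp (-(δ * (geo9K i).dist (sIK i bI z) y'))) * M at hP1
        have hgz := hg z z' hnear
        -- the correction term: `2 c_b b_b (w‖g₁−g₂‖) C₀ len(y(z′)) e(y(z′)) M ≤ CX·len(y)^{1−s}·e(y)·M`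
        have hl0' : 0 < (geo9K i).len (sIK i bI z) := geo9K_len_pos i _
        have hcorr : 2 * coordBound39 b * basisBound39 b * (wSN i s z z' * ‖(par₁ (cfg U₁) z z' : 𝔸) - (par₂ (cfg U₁) z z' : 𝔸)‖) *
            (C₀ * (geo9K i).len (sIK i bI z') * Real.exp (-(δ * (geo9K i).dist (sIK i bI z') y')) * M) ≤
            CX * (geo9K i).len (sIK i bI z) ^ (1 - s) * Real.exp (-(δ * (geo9K i).dist (sIK i bI z) y')) * M := by
          have hA : 0 ≤ 2 * coordBound39 b * basisBound39 b := by positivity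
          have hB : C₀ * (geo9K i).len (sIK i bI z') * Real.exp (-(δ * (geo9K i).dist (sIK i bI z') y')) * M ≤
              C₀ * (((ℓ : ℝ) + 1) * (geo9K i).len (sIK i bI z)) * (Real.exp (δ * r₀) * Real.exp (-(δ * (geo9K i).dist (sIK i bI z) y'))) * M := by
            have e1 := Real.exp_nonneg (-(δ * (geo9K i).dist (sIK i bI z') y'))
            have := mul_le_mul (mul_le_mul_of_nonneg_left hlen hC₀) hexp e1 (by positivity)
            exact mul_le_mul_of_nonneg_right this hM
          have hB0 : 0 ≤ C₀ * (geo9K i).len (sIK i bI z') * Real.exp (-(δ * (geo9K i).dist (sIK i bI z') y')) * M := by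
            have := geo9K_len_pos i (sIK i bI z'); positivity
          calc _ ≤ 2 * coordBound39 b * basisBound39 b * (θ * (geo9K i).len (sIK i bI z) ^ (-s)) *
                (C₀ * (((ℓ : ℝ) + 1) * (geo9K i).len (sIK i bI z)) * (Real.exp (δ * r₀) * Real.exp (-(δ * (geo9K i).dist (sIK i bI z) y'))) * M) :=
                mul_le_mul (mul_le_mul_of_nonneg_left hgz hA) hB hB0 (by positivity)
            _ = CX * ((geo9K i).len (sIK i bI z) ^ (-s) * (geo9K i).len (sIK i bI z)) * Real.exp (-(δ * (geo9K i).dist (sIK i bI z) y')) * M := by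
                rw [hCX]; ring
            _ = CX * (geo9K i).len (sIK i bI z) ^ (1 - s) * Real.exp (-(δ * (geo9K i).dist (sIK i bI z) y')) * M := by
                rw [show (1 : ℝ) - s = -s + 1 by ring, Real.rpow_add hl0', Real.rpow_one]
        have hsum : |((holderProbesSN i b B cfg par₂ bI).ΦX U₁ s (T μ)) (Sum.inl ((z, z'), ν, c, c'))| ≤
            (Cb + CX) * (geo9K i).len (sIK i bI z) ^ (1 - s) * Real.exp (-(δ * (geo9K i).dist (sIK i bI z) y')) * M := by
          refine h1.trans ?_
          have := add_le_add hP1 hcorr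
          refine this.trans (le_of_eq ?_)
          ring
        exact hup1 (C := Cb + CX) (by rw [hCtot]; linarith) (by linarith) hsum
      · rw [ΦX_SN_inl_of_not_near i b B cfg par₂ U₁ s (T μ) hnear ν c c', abs_zero]
        have hl : 0 ≤ (geo9K i).len (sIK i bI z) ^ (1 - s) := Real.rpow_nonneg (le_of_lt (geo9K_len_pos i _)) _
        positivity
    · -- transported point probe anchored at `y = y(z′)`
      have hz : sIK i bI z' = y := hidx
      subst hz
      have h := transProbe_le_of_supS i b cfg U₁ par₂ hu₂ (T μ) hF0 s z z' ν c c'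
      exact hup0 (C := CT) (by rw [hCtot]; linarith) hCT0 (h.trans (le_of_eq (by rw [hCT]; ring)))
    · -- point probe anchored at `y = y(z)`
      have hz : sIK i bI z = y := hidx
      subst hz
      exact hup0 (C := C₀) (by rw [hCtot]; linarith) hC₀ (pointProbe_le_of_supS i b cfg U₁ par₂ (T μ) hF0 s z ν c c')
  -- assemble the `𝔠_P^{(s−1)}` size at `y`
  have hlen0 : 0 < (geo9K i).len y := geo9K_len_pos i y
  have hloc : (BlockNorm.ofBlocks (toB6 (geo9K i) R₀ H₀) (blkPK (sIK i bI))).loc y (((holderProbesSN i b B cfg par₂ bI).ΦX U₁ s ∘ₗ T) μ) ≤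
      Ctot * (geo9K i).len y ^ (1 - s) * Real.exp (-(δ * (geo9K i).dist y y')) * M :=
    ofBlocks_loc_le_of_forall i (blkPK (sIK i bI)) (by positivity) hpt
  show (cNormR R₀ H₀ (blkPK (sIK i bI)) hG.lenle (s - 1)).loc y (((holderProbesSN i b B cfg par₂ bI).ΦX U₁ s ∘ₗ T) μ) ≤
    Ctot * Real.exp (-(δ * (geo9K i).dist y y')) * M
  rw [cNormR_loc]
  calc (geo9K i).len y ^ (s - 1) *
        (BlockNorm.ofBlocks (toB6 (geo9K i) R₀ H₀) (blkPK (sIK i bI))).loc y (((holderProbesSN i b B cfg par₂ bI).ΦX U₁ s ∘ₗ T) μ)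
      ≤ (geo9K i).len y ^ (s - 1) * (Ctot * (geo9K i).len y ^ (1 - s) * Real.exp (-(δ * (geo9K i).dist y y')) * M) :=
        mul_le_mul_of_nonneg_left hloc (Real.rpow_nonneg hlen0.le _)
    _ = Ctot * ((geo9K i).len y ^ (s - 1) * (geo9K i).len y ^ (1 - s)) * Real.exp (-(δ * (geo9K i).dist y y')) * M := by ring
    _ = Ctot * Real.exp (-(δ * (geo9K i).dist y y')) * M := by
        rw [← Real.rpow_add hlen0, show s - 1 + (1 - s) = 0 by ring, Real.rpow_zero, mul_one]

end Package

/-! ## §3 At NODE 00's record: the `parSY` (= `taxiS`) probe member from the `parSymY` one under print's (3.35) -/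

section Record

open scoped Matrix.Norms.L2Operator

variable (i : KIdx d ℓ hd hL b₀ b₁)

/-- real arithmetic of the pair weight against the two-route defect: `((T∕N)^s)⁻¹·A·(T∕Lʲ)² ≤ A·(Lʲ∕N)^{−s}` for `0 < T ≤ Lʲ`, `0 ≤ s ≤ 2`.
[cite: Balaban1985BackgroundPropagators, (3.40) p.397, bookkeeping] -/
private theorem weight_defect_aux {A T Lj N s : ℝ} (hA : 0 ≤ A) (hT : 0 < T) (hLj : 0 < Lj) (hN : 0 < N) (hTL : T ≤ Lj) (hs2 : s ≤ 2) :
    ((T / N) ^ s)⁻¹ * (A * (T / Lj) ^ 2) ≤ A * (Lj / N) ^ (-s) := by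
  set u : ℝ := T / Lj with hu
  set len : ℝ := Lj / N with hlen
  have hu0 : 0 < u := div_pos hT hLj
  have hu1 : u ≤ 1 := (div_le_one hLj).2 hTL
  have hlen0 : 0 < len := div_pos hLj hN
  have hTN : T / N = u * len := by rw [hu, hlen]; field_simp
  rw [hTN, Real.mul_rpow hu0.le hlen0.le, Real.rpow_neg hlen0.le]
  have hu2 : u ^ (2 : ℕ) = u ^ s * u ^ (2 - s) := by
    rw [← Real.rpow_natCast u 2, ← Real.rpow_add hu0]; norm_num
  rw [hu2]
  have hus : 0 < u ^ s := Real.rpow_pos_of_pos hu0 s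
  have hls : 0 < len ^ s := Real.rpow_pos_of_pos hlen0 s
  have hu2s : u ^ (2 - s) ≤ 1 := Real.rpow_le_one hu0.le hu1 (by linarith)
  calc (u ^ s * len ^ s)⁻¹ * (A * (u ^ s * u ^ (2 - s))) = A * u ^ (2 - s) * (len ^ s)⁻¹ := by
        field_simp
    _ ≤ A * 1 * (len ^ s)⁻¹ := by
        refine mul_le_mul_of_nonneg_right (mul_le_mul_of_nonneg_left hu2s hA) (inv_nonneg.2 hls.le)
    _ = A * (len ^ s)⁻¹ := by ring

/-- ★ **THE PAIR WEIGHT EATS THE TWO-ROUTE DEFECT**: under print's (3.35) (`bg9KP`, `c ≤ 10`, `G` unit-normed) and the pins `hlev`, `hcf`, for a near pair and `0 ≤ s ≤ 2`: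
`w_s(z,z′)·‖parSymY U z z′ − parSY U z z′‖ ≤ (d+1)²·K_pl·L⁶ · len(y(z))^{−s}` (`s ≤ 2`) — `(η|z−z′|_T)^{−s}·(|z−z′|_T∕Lʲ)² = (|z−z′|_T∕Lʲ)^{2−s}·(Lʲη)^{−s} ≤ (Lʲη)^{−s}`.
[cite: Balaban1985BackgroundPropagators, (3.40) p.397, (3.69) p.404, (3.35) p.396] -/
theorem wSN_mul_norm_parSymY_sub_parSY_le {N : ℕ} [Nonempty (Fin N)] {G : Subgroup (Matrix (Fin N) (Fin N) ℂ)ˣ}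
    (U : CfgY (Matrix (Fin N) (Fin N) ℂ) i) {c α₀ : ℝ} (hc : c ≤ 10) (hMα : 0 ≤ (kGeo i).M * α₀)
    (hreg : (bg9KP (Matrix (Fin N) (Fin N) ℂ) G i).Reg335 c α₀ U) (hG1 : ∀ u : (Matrix (Fin N) (Fin N) ℂ)ˣ, u ∈ G → ‖(u : Matrix (Fin N) (Fin N) ℂ)‖ ≤ 1)
    {bI : FBondY i → IBondY i} (hlev : ∀ x : FBondY i, lvl i.hN i.D i.hk (bI x) = (blkV1 i.hN i.D x).1.1) (hcf : |i.cf| = (nKT (toKT i) : ℝ))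
    {s : ℝ} (hs2 : s ≤ 2) {z z' : SiteY i} (hnear : NearS i z z') :
    wSN i s z z' * ‖(parSymY i U z z' : Matrix (Fin N) (Fin N) ℂ) - (parSY i U z z' : Matrix (Fin N) (Fin N) ℂ)‖ ≤
      ((((d + 1 : ℕ) : ℝ)) ^ 2 *
        (2 * (10 * (kGeo i).L * ((kGeo i).M * α₀)) * (1 + 10 * (kGeo i).L * ((kGeo i).M * α₀)) * Real.exp (4 * (10 * (kGeo i).L * ((kGeo i).M * α₀)))) *
        (kGeo i).L ^ 6) * (geo9K i).len (sIK i bI z) ^ (-s) := by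
  set A : ℝ := (((d + 1 : ℕ) : ℝ)) ^ 2 *
    (2 * (10 * (kGeo i).L * ((kGeo i).M * α₀)) * (1 + 10 * (kGeo i).L * ((kGeo i).M * α₀)) * Real.exp (4 * (10 * (kGeo i).L * ((kGeo i).M * α₀)))) *
    (kGeo i).L ^ 6 with hA
  have hL1 : (1 : ℝ) ≤ (kGeo i).L := B9Eq335PlaquetteAtLettersY.one_le_L i
  have hL0 : (0 : ℝ) < (kGeo i).L := lt_of_lt_of_le one_pos hL1
  have hA0 : 0 ≤ A := by rw [hA]; positivity
  -- the anchor's length: `len(y(z)) = L^{lev z} ∕ N`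
  have hNpos : (0 : ℝ) < (nKT (toKT i) : ℝ) := by exact_mod_cast nKT_pos (toKT i)
  have hlenz : (geo9K i).len (sIK i bI z) = (kGeo i).L ^ levY i z / (nKT (toKT i) : ℝ) := by
    show (kGeo i).len (bI ⟨(boxEquiv i.hN).symm z, 0⟩) = _
    rw [len_eq, hlev, blkV1_site, hcf]
    rfl
  by_cases hzz : z = z'
  · subst hzz
    rw [Node00.parSymY_of_le le_rfl, sub_self, norm_zero, mul_zero]
    exact mul_nonneg hA0 (Real.rpow_nonneg (le_of_lt (geo9K_len_pos i _)) _)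
  · -- the defect of the two tables and the weight
    have hdef := norm_parSymY_sub_parSY_le_of_reg335P i U hc hMα hreg hG1 hnear
    have hT0 : 0 < torusSupNorm (toKT i).NB (z.1 - z'.1) := by
      have h := pdist_pos_of_ne i hzz
      unfold pdist at h
      rw [← neg_sub z.1 z'.1, torusSupNorm_neg (fun μ => one_le_of_mem z.2 μ)] at h
      exact (div_pos_iff_of_pos_right hNpos).1 h
    have hw : wSN i s z z' = ((torusSupNorm (toKT i).NB (z.1 - z'.1) / (nKT (toKT i) : ℝ)) ^ s)⁻¹ := by
      rw [wSN_of_near i s hnear, wS, ← neg_sub z.1 z'.1, torusSupNorm_neg (fun μ => one_le_of_mem z.2 μ)]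
    have hLj : 0 < (kGeo i).L ^ levY i z := pow_pos hL0 _
    have hTL : torusSupNorm (toKT i).NB (z.1 - z'.1) ≤ (kGeo i).L ^ levY i z := hnear
    rw [hw, hlenz]
    have hw0 : 0 ≤ ((torusSupNorm (toKT i).NB (z.1 - z'.1) / (nKT (toKT i) : ℝ)) ^ s)⁻¹ :=
      inv_nonneg.2 (Real.rpow_nonneg (div_nonneg hT0.le hNpos.le) _)
    calc ((torusSupNorm (toKT i).NB (z.1 - z'.1) / (nKT (toKT i) : ℝ)) ^ s)⁻¹ *
          ‖(parSymY i U z z' : Matrix (Fin N) (Fin N) ℂ) - (parSY i U z z' : Matrix (Fin N) (Fin N) ℂ)‖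
        ≤ ((torusSupNorm (toKT i).NB (z.1 - z'.1) / (nKT (toKT i) : ℝ)) ^ s)⁻¹ * (A * (torusSupNorm (toKT i).NB (z.1 - z'.1) / (kGeo i).L ^ levY i z) ^ 2) :=
          mul_le_mul_of_nonneg_left hdef hw0
      _ ≤ A * ((kGeo i).L ^ levY i z / (nKT (toKT i) : ℝ)) ^ (-s) := weight_defect_aux hA0 hT0 hLj hNpos hTL hs2

omit [DecidableEq κ] in
/-- ★★★ **THE NEAR-CARRIER PROBE MEMBER AT `taxiS = parSY` FROM THE ONE AT THE RECORD's `parSymY` UNDER PRINT's (3.35).**  For a member `x` of the record with letters in the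
matrix algebra, `U` in print's class (`bg9KP`, `c ≤ 10`, `G` unit-normed), the pins `hlev hβ1 hcf`, ANY source class `b`, ANY `T` into the site carrier, `0 ≤ s ≤ 2`:
the `𝔠_P^{(s−1)}` member of `Φ_s(parSymY)∘T` (`C_b e^{−δd}` — rows 18's engine output at `holderProbesSN … (𝔏 x).parS`) and the `𝔠^{(−1)}` member of `T` (`C₀ e^{−δd}`) give the
`𝔠_P^{(s−1)}` member of `Φ_s(parSY)∘T` with `(C_b + 2c_b b_b·L·e^{δr₀}·(d+1)²K_pl L⁶·C₀ + c_b b_b C₀ + C₀)·e^{−δd}` — the probe member the rows-20–21 site class `bH13 = bHZPG (taxiS U)`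
is fed from. [cite: Balaban1985BackgroundPropagators, (3.40) p.397 + (3.42)–(3.43) pp.397–398 + (3.35) p.396; Balaban1984PropagatorsII, (2.51)–(2.54) pp.232–233] -/
theorem hasMaj_probesSN_parSY_of_parSymY {N : ℕ} [Nonempty (Fin N)] (b : Module.Basis κ ℝ (Matrix (Fin N) (Fin N) ℂ)) [Fintype (geo9K i).Site]
    (hG : GeoOK (geo9K i)) {B : B9.Backgrounds} (cfg : B.Cfg → CfgY (Matrix (Fin N) (Fin N) ℂ) i) (U₁ : B.Cfg)
    {G : Subgroup (Matrix (Fin N) (Fin N) ℂ)ˣ} {c α₀ : ℝ} (hc : c ≤ 10) (hMα : 0 ≤ (kGeo i).M * α₀)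
    (hreg : (bg9KP (Matrix (Fin N) (Fin N) ℂ) G i).Reg335 c α₀ (cfg U₁)) (hG1 : ∀ u : (Matrix (Fin N) (Fin N) ℂ)ˣ, u ∈ G → ‖(u : Matrix (Fin N) (Fin N) ℂ)‖ ≤ 1)
    {bI : FBondY i → IBondY i} (hlev : ∀ x : FBondY i, lvl i.hN i.D i.hk (bI x) = (blkV1 i.hN i.D x).1.1)
    (hβ1 : ∀ x : FBondY i, (geomT i.D).dist (β i.hN i.D i.hk (bI x)) (blkV1 i.hN i.D x) ≤ 1) (hcf : |i.cf| = (nKT (toKT i) : ℝ))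
    {s : ℝ} (hs0 : 0 ≤ s) (hs2 : s ≤ 2)
    {R₀ : ℝ} {H₀ : Prop} {F₁ : Type} [AddCommGroup F₁] [Module ℝ F₁]
    {bS : BlockNorm (toB6 (geo9K i) R₀ H₀) F₁} {T : F₁ →ₗ[ℝ] (XSK κ i → ℝ)} {C₀ Cb δ : ℝ} (hC₀ : 0 ≤ C₀) (hCb : 0 ≤ Cb) (hδ : 0 ≤ δ)
    (hsup : HasMaj bS (cNormR R₀ H₀ (blkSK i (sIK i bI)) hG.lenle (-1)) T (fun a a' => C₀ * Real.exp (-(δ * (geo9K i).dist a a'))))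
    (hpr : HasMaj bS (cNormR R₀ H₀ (blkPK (sIK i bI)) hG.lenle (s - 1)) ((holderProbesSN i b B cfg (parSymY i) bI).ΦX U₁ s ∘ₗ T)
      (fun a a' => Cb * Real.exp (-(δ * (geo9K i).dist a a')))) :
    HasMaj bS (cNormR R₀ H₀ (blkPK (sIK i bI)) hG.lenle (s - 1)) ((holderProbesSN i b B cfg (parSY i) bI).ΦX U₁ s ∘ₗ T)
      (fun a a' => (Cb + 2 * coordBound39 b * basisBound39 b * ((ℓ : ℝ) + 1) * Real.exp (δ * (((d : ℝ) + 1) * (((ℓ : ℝ) + 1) + 1) + 2)) *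
        ((((d + 1 : ℕ) : ℝ)) ^ 2 *
          (2 * (10 * (kGeo i).L * ((kGeo i).M * α₀)) * (1 + 10 * (kGeo i).L * ((kGeo i).M * α₀)) * Real.exp (4 * (10 * (kGeo i).L * ((kGeo i).M * α₀)))) *
          (kGeo i).L ^ 6) * C₀ +
        coordBound39 b * basisBound39 b * C₀ + C₀) * Real.exp (-(δ * (geo9K i).dist a a'))) := by
  have hU : ∀ μ x, UnitaryLike (cfg U₁ μ x) := fun μ x =>
    B9SectBGpLettersY.norm_le_one_and_inv_of_mem G hG1 (B9BackgroundsKLevelV1P.mem_of_reg335P i hreg μ x)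
  haveI : Nonempty (Fin (PV d ℓ i.m i.K hd hL).d) := ⟨⟨0, Nat.succ_pos d⟩⟩
  have hu₂ : ∀ z z' : SiteY i, UnitaryLike (parSY i (cfg U₁) z z') := fun z z' => unitaryLike_parTaxiV hU _ _
  have hu₁ : ∀ z z' : SiteY i, UnitaryLike (parSymY i (cfg U₁) z z') := by
    intro z z'
    by_cases hle : toLex z.1 ≤ toLex z'.1
    · rw [Node00.parSymY_of_le hle]; exact hu₂ z z'
    · rw [Node00.parSymY_of_not_le hle]; exact (hu₂ z' z).inv
  have hL1 : (1 : ℝ) ≤ (kGeo i).L := B9Eq335PlaquetteAtLettersY.one_le_L i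
  have hθ : 0 ≤ (((d + 1 : ℕ) : ℝ)) ^ 2 *
      (2 * (10 * (kGeo i).L * ((kGeo i).M * α₀)) * (1 + 10 * (kGeo i).L * ((kGeo i).M * α₀)) * Real.exp (4 * (10 * (kGeo i).L * ((kGeo i).M * α₀)))) *
      (kGeo i).L ^ 6 := by positivity
  exact hasMaj_probesSN_transfer i b cfg U₁ hG (parSymY i) (parSY i) hu₁ hu₂ hlev hβ1 hcf hs0 hθ
    (fun z z' hzz => wSN_mul_norm_parSymY_sub_parSY_le i (cfg U₁) hc hMα hreg hG1 hlev hcf hs2 hzz) hC₀ hCb hδ hsup hpr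

end Record

end

end Literature.MathematicalPhysics.QuantumFieldTheory.Balaban1983to89.B9Eq340ProbeTransferSNY
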